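import Summits.Ventures.PercRepro.RankLevelSetBiIndepPerElemModel
import Summits.Ventures.PercRepro.RankLevelSetBiIndepLR

/-! # RankLevelSetBiIndepLRUniform — THE UNIFORM MATROIDS SATISFY THE LIKELIHOOD-RATIO MONOTONICITY (LR)
(night-1 g26; dossier §38.10)

The model matroid with `F = ∅` is the uniform matroid `U_{p,E}` (every set of size `≤ p` independent). Its marked
profiles are windows of one binomial row: `a_j = C(n−1, j)` when `j + 1` and `n − j − 1` are `≤ p`, else `0`, and
`b_j = C(n−1, j)` when `j` and `n − j` are `≤ p`, else `0` (`yThroughCount_uniform`, `yAvoidCount_uniform`; the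
through-`y` `(j+1)`-sets are the `j`-subsets of `E ∖ {y}` by `Q ↦ Q ∖ {y}`). A TP2 inequality `a_q b_p ≤ a_p b_q`
(`p ≤ q`) is trivial when its left side vanishes, and otherwise both sides are the same product of binomials
(`biIndepLR_uniform`). So the (LR)-class has its first explicit members beyond the closure operations; with
`biIndepLR_disjointSum_of_ULC` / `biIndepLR_truncateTo` it contains every truncation of a direct sum of uniform
matroids (given the ULC fact for the summands). Nothing here asserts (LR); every declaration has a docstring;
imports: the cell's own modules and Mathlib only. Axioms: standard. -/

namespace PercRepro

open Set Matroid

variable {α : Type}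

/-- Bi-independence in the uniform model: `S ⊆ E`, `#S = r`, `r ≤ p` and `#E − r ≤ p`. -/
lemma uniform_mem_biIndep_iff {E : Set α} (hE : E.Finite) (q p r : ℕ) (S : Set α) :
    S ∈ biIndep (modelMatroid hE ∅ q p) r ↔ S ⊆ E ∧ S.ncard = r ∧ r ≤ p ∧ E.ncard - r ≤ p := by
  rw [model_mem_biIndep_iff]
  constructor
  · rintro ⟨hSE, hr, -, h2, -, h4⟩
    refine ⟨hSE, hr, hr ▸ h2, ?_⟩
    rw [Set.ncard_sdiff' hSE hE, hr] at h4
    exact h4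
  · rintro ⟨hSE, hr, h2, h4⟩
    refine ⟨hSE, hr, by simp, hr ▸ h2, by simp, ?_⟩
    rw [Set.ncard_sdiff' hSE hE, hr]
    exact h4

/-- **The `j`-subsets of a finite set number `C(#Z, j)`** (the Set-level form of `ncard_subsets_ncard_eq`). -/
lemma ncard_subsets_of_finite {Z : Set α} (hZ : Z.Finite) (j : ℕ) :
    {Y : Set α | Y ⊆ Z ∧ Y.ncard = j}.ncard = Z.ncard.choose j := by
  have h := ncard_subsets_ncard_eq hZ.toFinset j
  rw [hZ.coe_toFinset, ← Set.ncard_eq_toFinset_card Z hZ] at h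
  exact h

/-- **The through-`y` count of the uniform model**: `a_j = C(#E − 1, j)` inside the window `j + 1 ≤ p`,
`#E − (j + 1) ≤ p`, and `0` outside. -/
lemma yThroughCount_uniform {E : Set α} (hE : E.Finite) (q p : ℕ) {y : α} (hy : y ∈ E) (j : ℕ) :
    haveI := modelMatroid_finite hE ∅ q p
    yThroughCount (modelMatroid hE ∅ q p) y j =
      if j + 1 ≤ p ∧ E.ncard - (j + 1) ≤ p then (E.ncard - 1).choose j else 0 := by
  haveI := modelMatroid_finite hE ∅ q p
  unfold yThroughCount
  have hE' : (E \ {y}).Finite := hE.subset Set.sdiff_subset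
  have hE'card : (E \ {y}).ncard = E.ncard - 1 := by
    rw [Set.ncard_sdiff' (Set.singleton_subset_iff.mpr hy) hE, Set.ncard_singleton]
  split_ifs with hw
  · -- `Q ↦ Q ∖ {y}` is a bijection onto the `j`-subsets of `E ∖ {y}`
    rw [← hE'card, ← ncard_subsets_of_finite hE' j]
    refine Set.ncard_congr (fun Q _ => Q \ {y}) ?_ ?_ ?_
    · rintro Q ⟨hQ, hyQ⟩
      rw [uniform_mem_biIndep_iff] at hQ
      refine ⟨Set.sdiff_subset_sdiff_left hQ.1, ?_⟩
      rw [Set.ncard_sdiff' (Set.singleton_subset_iff.mpr hyQ) (hE.subset hQ.1), Set.ncard_singleton, hQ.2.1]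
      rfl
    · rintro Q Q' ⟨-, hyQ⟩ ⟨-, hyQ'⟩ hQQ'
      have e : Q = insert y (Q \ {y}) := (Set.insert_sdiff_singleton.trans (Set.insert_eq_of_mem hyQ)).symm
      have e' : Q' = insert y (Q' \ {y}) := (Set.insert_sdiff_singleton.trans (Set.insert_eq_of_mem hyQ')).symm
      rw [e, e', hQQ']
    · rintro Y ⟨hYE, hYcard⟩
      have hyY : y ∉ Y := fun h => (hYE h).2 rfl
      refine ⟨insert y Y, ⟨?_, Set.mem_insert y Y⟩, ?_⟩
      · rw [uniform_mem_biIndep_iff]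
        refine ⟨Set.insert_subset hy (hYE.trans Set.sdiff_subset), ?_, hw.1, hw.2⟩
        rw [Set.ncard_insert_of_notMem hyY (hE'.subset hYE), hYcard]
      · rw [Set.insert_sdiff_of_mem _ (Set.mem_singleton y), Set.sdiff_singleton_eq_self hyY]
  · rw [Set.ncard_eq_zero ((biIndep_finite _ (j + 1)).subset (fun S hS => hS.1))]
    ext Q
    simp only [Set.mem_setOf_eq, Set.mem_empty_iff_false, iff_false, not_and]
    intro hQ _
    rw [uniform_mem_biIndep_iff] at hQ
    exact hw ⟨hQ.2.2.1, hQ.2.2.2⟩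

/-- **The avoid-`y` count of the uniform model**: `b_j = C(#E − 1, j)` inside the window `j ≤ p`, `#E − j ≤ p`,
and `0` outside. -/
lemma yAvoidCount_uniform {E : Set α} (hE : E.Finite) (q p : ℕ) {y : α} (hy : y ∈ E) (j : ℕ) :
    haveI := modelMatroid_finite hE ∅ q p
    yAvoidCount (modelMatroid hE ∅ q p) y j =
      if j ≤ p ∧ E.ncard - j ≤ p then (E.ncard - 1).choose j else 0 := by
  haveI := modelMatroid_finite hE ∅ q p
  unfold yAvoidCount
  have hE' : (E \ {y}).Finite := hE.subset Set.sdiff_subset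
  have hE'card : (E \ {y}).ncard = E.ncard - 1 := by
    rw [Set.ncard_sdiff' (Set.singleton_subset_iff.mpr hy) hE, Set.ncard_singleton]
  split_ifs with hw
  · rw [← hE'card, ← ncard_subsets_of_finite hE' j]
    congr 1
    ext Z
    simp only [Set.mem_setOf_eq, uniform_mem_biIndep_iff]
    constructor
    · rintro ⟨⟨hZE, hZcard, -, -⟩, hyZ⟩
      exact ⟨fun x hx => ⟨hZE hx, fun hxy => hyZ (hxy ▸ hx)⟩, hZcard⟩
    · rintro ⟨hZE, hZcard⟩
      exact ⟨⟨hZE.trans Set.sdiff_subset, hZcard, hw.1, hw.2⟩, fun h => (hZE h).2 rfl⟩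
  · rw [Set.ncard_eq_zero ((biIndep_finite _ j).subset (fun S hS => hS.1))]
    ext Z
    simp only [Set.mem_setOf_eq, Set.mem_empty_iff_false, iff_false, not_and]
    intro hZ _
    rw [uniform_mem_biIndep_iff] at hZ
    exact hw ⟨hZ.2.2.1, hZ.2.2.2⟩

/-- **THE UNIFORM MATROIDS SATISFY (LR)**: `BiIndepLR (modelMatroid hE ∅ q p)` for every finite `E` and all `q, p`. -/
theorem biIndepLR_uniform {E : Set α} (hE : E.Finite) (q p : ℕ) :
    haveI := modelMatroid_finite hE ∅ q p
    BiIndepLR (modelMatroid hE ∅ q p) := by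
  haveI := modelMatroid_finite hE ∅ q p
  intro y hy i k hik
  have hyE : y ∈ E := hy
  rw [yThroughCount_uniform hE q p hyE, yThroughCount_uniform hE q p hyE, yAvoidCount_uniform hE q p hyE,
    yAvoidCount_uniform hE q p hyE]
  by_cases hk : k + 1 ≤ p ∧ E.ncard - (k + 1) ≤ p
  · by_cases hi : i ≤ p ∧ E.ncard - i ≤ p
    · rw [if_pos hk, if_pos hi, if_pos (by omega), if_pos (by omega), mul_comm]
    · rw [if_neg hi, mul_zero]
      exact Nat.zero_le _
  · rw [if_neg hk, zero_mul]
    exact Nat.zero_le _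

end PercRepro
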